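import Literature.MathematicalPhysics.QuantumFieldTheory.Balaban1983to89.Node00.Record13NumericsOfThm1CCM

/-!
# NODE 00 (YM-PLAN Track A) — STAGE 13: THE WINDOW LETTER OF THE COLLARED [15]-WITNESS — `θ₁₅ᶜᶜᴹ(j; γ)` with the small-coupling window `γ ∈ ]0, ½]` a PARAMETER
# (everything else the collared member's: `M = M₁ = L^j`, `A₀ = A₀ᶜᶜ¹`, `εreg = a₀`, `p₀ = r = 1`, `cB = 6L + 1`, `B·C·M_r = 7`, `cR = 1`, `β = ¼`, `εbg = 1`, `A₁ = 1`)

Cell `pub-ymgap`, seat `pub-ymgap-dag-n21-c` (g12), dag-lead WORDS-144 pen (γ) «THE WITNESS RE-PIN», continued on plan g76's V15 stub 3′ `stub_betaBoxAtThm1WitnessCCM13`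
(the β-box of the ⁷ provisos at `θ₁₅ᶜᶜᴹ(3)` ON THE WINDOW `]0, ½]`).  FILE A1ʷ of the window edition (A2ʷ = `Node00/Record13LettersOfThm1CCMW`: letters, pins, the β TRANSFER on the
box `]0, γ]`, history clauses; Bʷ = `Node00/Record13SepCoPInhabitedOfThm1CCMWGaugeR`: closers).  NEW leaf; A1 `Record13NumericsOfThm1CCM` CONSUMED BY NAME, nothing modified; the
`γ = ½` member IS A1's witness (`theta13OfThm1CCMW_half`, `rfl`) — this family is ADDITIVE.  `--kind definition --supports stmt-QuantumFields-20541`.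
[15] = [Balaban1985Variational], [6] = [Balaban1985RegularSpaces], [III] = [Balaban1988Convergent], [I] = [Balaban1987RG1], [II] = [Balaban1989LargeFieldII], [IV] = [Balaban1989LargeFieldI].

WHY (LOCATED by this seat, g12).  Stub 3′ asks for `BetaLowerH b ½ (betaOfRecord₁₃ F 2 θ₁₅ᶜᶜᴹ(3)) ∧ BetaUpperH β′ ½ (…)` with `0 ≤ b`, `β′ ≤ 3`: the SIGN and a uniform bound of [I]'s
β-functions (1.20)–(1.22) on EVERY coupling history in `]0, ½]^{k+1}`, at every step `k`.  The window numeral `½` is K0a's displayed default (`stage12NumericsOfFamily`: `γ := ½`), NOT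
print's `γ`: [I] Thm 1 p.259 ∕ §1 p.264 define and control `β_{k+1}(g_j)` only for `g_j ∈ [0, γ]` with «γ sufficiently small», and [II] p.355 ∕ (1.4) p.357 announce positivity «for g_k
sufficiently small» (second-order perturbation theory).  Every typed road to the β-box in the tree is of the same shape: the K2 lane's registered pair gives `∃ γ₀ ∈ ]0, θ.γ], BetaUpperH β′ γ₀ ∧
BetaLowerH (−β′) γ₀ ∧ BetaContH γ₀` (`…N26AtRecord13BetaBoxOfDriftAtSlope.exists_betaBox_betaOfRecord₁₃_of_registeredPair`), the DAG leaf `DagBinding.betaPositive` is along-run with the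
world's own window.  A β-box on the FIXED window `½` (couplings up to `g = 0.5`) is therefore beyond what NODE O's perturbative road can deliver, while the K0 provisos read the window only
through `Step.InInterval θ.γ` (smaller window = fewer windowed runs) and the gauge-road letters need only `γ ≤ ½` (`g² ≤ e⁻¹`, `log g⁻² > 1`, `ε(g′) ≤ 2ε(g)` for `g ≤ g′ ≤ ½`).  Hence the
window must be a LETTER of the witness, pinned later to NODE O's `γ₀`: this file.

WHAT THIS FILE PROVIDES (definitions + `rfl` views + elementary faces).
* §1 `stage12NumericsOfThm1CCMW L j γ ε₀ B₃ B₃' a₀ a₁ := { stage12NumericsOfThm1CCM L j ε₀ B₃ B₃' a₀ a₁ with γ := γ }` — its `rfl` views (every non-`γ` letter IS the collared member's),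
  `stage12NumericsOfThm1CCMW_half` (`γ := ½` gives back A1's numerics, `rfl`), `stage12NumericsOfThm1CCMW_pos` under `0 < γ < 1` and A1's six signs.
* §2 the witness `theta13OfThm1CCMW F N j γ ε₀ ε₂₉ B₃ B₃' a₀ a₁ := theta13LiveOfNumerics F N (stage12NumericsOfThm1CCMW F.L j γ …) ε₂₉ (ζ, Rz, Zt of record)` — a MEMBER of FILE 9's
  all-numerics family (`rfl`); ★ `theta13OfThm1CCMW_half : θ₁₅ᶜᶜᴹ(j; ½) = θ₁₅ᶜᶜᴹ(j)` (`rfl`); its `rfl` views (`_γ : θ.γ = γ`, `_M₁`, `_τ9_M`, …, `lfOfRecord₁₂_` with `γ := γ`) and faces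
  (`admissible_` under `0 < γ < 1`, `hasResidualsOfRecord_`, `ztUnity_`, `slotsNondegenerate₁₃_` hypothesis-free, `eight_le_L_`, `kp_tree_∕kp_large_∕kp_n10_`).

HONEST FRAMING.  Bookkeeping of a re-pinned parameter family + elementary arithmetic; the numerals are displayed choices, not Bałaban's constants; nothing of Bałaban asserted;
NOT a discharge; K0⁷ NOT closed by this file (V15 stubs: [15] Prop. 8 top step, [6] Prop. 6 at the member, the β-box, the small-torus residual); counts unmoved (typed 28∕28 ·
discharged 5∕27); one finite 𝕋⁴ programme at fixed ε — NOT continuum ∕ OS ∕ mass gap ∕ Clay.  No `sorry`, no `axiom`, no `instance`, no `notation`.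
-/

noncomputable section

open MeasureTheory
open scoped Matrix.Norms.L2Operator

namespace Literature.MathematicalPhysics.QuantumFieldTheory.Balaban1983to89.Node00

open T4Continuum B14.Eq218Concrete B15DeterminingSets B12RegularSpaces111 B14RegularSpaces234 FlowStep FlowStepRuns

/-! ## §1. The windowed collared numerics: `γ` a parameter, everything else the collared member's -/

section Numerics

/-- **THE STAGE-12 NUMERICS OF THE COLLARED MEMBER WITH THE WINDOW A LETTER**: A1's `stage12NumericsOfThm1CCM L j ε₀ B₃ B₃' a₀ a₁` (`ν.M₁ = τ9.M = L^j`, `A₀ = A₀ᶜᶜ¹`, `εreg = a₀`,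
`p₀ = r = 1`, `s2 = sect2NumericsOfThm1C L`, `εbg = 1`, `A₁ = 1`) with the small-coupling window `γ := γ` ([I] Thm 1: «γ sufficiently small»; [III] (2.4): the thresholds are read along
runs in `]0, γ]`). [cite: Balaban1987RG1, Thm 1 p.259, (0.21) p.256, §1 p.264; Balaban1988Convergent, (2.4) p.255, (2.10) p.256 (bookkeeping witness)] -/
def stage12NumericsOfThm1CCMW (L j : ℕ) (γ ε₀ B₃ B₃' a₀ a₁ : ℝ) : Stage12Numerics :=
  { stage12NumericsOfThm1CCM L j ε₀ B₃ B₃' a₀ a₁ with γ := γ }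

variable (L j : ℕ) (γ ε₀ B₃ B₃' a₀ a₁ : ℝ)

/-- **THE `γ = ½` MEMBER IS A1's COLLARED NUMERICS** (`rfl`). [cite: Balaban1987RG1, Thm 1 p.259 (bookkeeping)] -/
theorem stage12NumericsOfThm1CCMW_half : stage12NumericsOfThm1CCMW L j (1 / 2) ε₀ B₃ B₃' a₀ a₁ = stage12NumericsOfThm1CCM L j ε₀ B₃ B₃' a₀ a₁ := rfl

/-- Its window constant IS the argument (`rfl`). [cite: Balaban1987RG1, Thm 1 p.259 (bookkeeping)] -/
theorem stage12NumericsOfThm1CCMW_γ : (stage12NumericsOfThm1CCMW L j γ ε₀ B₃ B₃' a₀ a₁).γ = γ := rfl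

/-- Its Stage-7 part IS the collared member's (`rfl`; `γ`-blind). [cite: Balaban1988Convergent, (2.4) p.255 (bookkeeping)] -/
theorem stage12NumericsOfThm1CCMW_ν : (stage12NumericsOfThm1CCMW L j γ ε₀ B₃ B₃' a₀ a₁).ν = numerics7OfThm1CCM L j ε₀ B₃ B₃' a₀ a₁ := rfl

/-- Its tower numerics ARE the collared member's (`rfl`). [cite: Balaban1989LargeFieldI, (2.1) p.182 (bookkeeping)] -/
theorem stage12NumericsOfThm1CCMW_τ9 : (stage12NumericsOfThm1CCMW L j γ ε₀ B₃ B₃' a₀ a₁).τ9 = towerNumericsOfThm1CCM L j := rfl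

/-- Its cube letter `τ9.M = L ^ j` (`rfl`). [cite: Balaban1989LargeFieldI, (2.1) p.182; Balaban1987RG1, (1.12) p.262 (bookkeeping)] -/
theorem stage12NumericsOfThm1CCMW_τ9_M : (stage12NumericsOfThm1CCMW L j γ ε₀ B₃ B₃' a₀ a₁).τ9.M = L ^ j := rfl

/-- Its separation width `ν.M₁ = L ^ j` (`rfl`). [cite: Balaban1985RegularSpaces, (1.3)–(1.6) p.77 (bookkeeping)] -/
theorem stage12NumericsOfThm1CCMW_M₁ : (stage12NumericsOfThm1CCMW L j γ ε₀ B₃ B₃' a₀ a₁).ν.M₁ = L ^ j := rfl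

/-- Its §2 numerics ARE FILE 11a's `sect2NumericsOfThm1C L` (`rfl`). [cite: Balaban1988Convergent, (2.28) p.259 (bookkeeping)] -/
theorem stage12NumericsOfThm1CCMW_s2 : (stage12NumericsOfThm1CCMW L j γ ε₀ B₃ B₃' a₀ a₁).s2 = sect2NumericsOfThm1C L := rfl

/-- Its located regularity constant is `cR = 1` (`rfl`). [cite: Balaban1988Convergent, (2.10) p.256 (bookkeeping)] -/
theorem stage12NumericsOfThm1CCMW_cR : (stage12NumericsOfThm1CCMW L j γ ε₀ B₃ B₃' a₀ a₁).s2.cR = 1 := rfl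

/-- Its (2.34) constant is `β = ¼` (`rfl`). [cite: Balaban1988Convergent, (2.34) p.261 (bookkeeping)] -/
theorem stage12NumericsOfThm1CCMW_βc : (stage12NumericsOfThm1CCMW L j γ ε₀ B₃ B₃' a₀ a₁).s2.βc = 1 / 4 := rfl

/-- Its term constants ARE the family's (`rfl`). [cite: Balaban1988Convergent, (2.28) p.259 (bookkeeping)] -/
theorem stage12NumericsOfThm1CCMW_lf : (stage12NumericsOfThm1CCMW L j γ ε₀ B₃ B₃' a₀ a₁).s2.lf = lfConstsOfFamily := rfl

/-- Its (1.16) constant is `A₁ = 1` (`rfl`). [cite: Balaban1987RG1, (1.16) p.262 (bookkeeping)] -/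
theorem stage12NumericsOfThm1CCMW_A₁ : (stage12NumericsOfThm1CCMW L j γ ε₀ B₃ B₃' a₀ a₁).A₁ = 1 := rfl

/-- Its background regularity radius IS the collared member's (`rfl`; `γ`-blind). [cite: Balaban1987RG1, (0.21) p.256 (bookkeeping)] -/
theorem stage12NumericsOfThm1CCMW_εbg : (stage12NumericsOfThm1CCMW L j γ ε₀ B₃ B₃' a₀ a₁).εbg = (stage12NumericsOfThm1CCM L j ε₀ B₃ B₃' a₀ a₁).εbg := rfl

/-- Its profile constant is `A₀ᶜᶜ¹` (`rfl`). [cite: Balaban1988Convergent, (2.4) p.255 (bookkeeping)] -/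
theorem stage12NumericsOfThm1CCMW_A₀ : (stage12NumericsOfThm1CCMW L j γ ε₀ B₃ B₃' a₀ a₁).ν.A₀ = A0OfThm1CC1 L B₃ B₃' a₀ a₁ := rfl

/-- Its regularity threshold is `a₀` (`rfl`). [cite: Balaban1985Variational, Thm 1 p.279 (bookkeeping)] -/
theorem stage12NumericsOfThm1CCMW_εreg : (stage12NumericsOfThm1CCMW L j γ ε₀ B₃ B₃' a₀ a₁).ν.εreg = a₀ := rfl

/-- **THE SMALL-FIELD THRESHOLDS ARE WINDOW-BLIND**: `epsOfRecord` of the windowed numerics IS the unit branch's (`rfl`). [cite: Balaban1988Convergent, (2.4) p.255 (bookkeeping)] -/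
theorem epsOfRecord_stage12NumericsOfThm1CCMW :
    epsOfRecord (stage12NumericsOfThm1CCMW L j γ ε₀ B₃ B₃' a₀ a₁).ν = epsOfRecord (numerics7OfThm1CC1 L ε₀ B₃ B₃' a₀ a₁) := rfl

variable {L j γ ε₀ B₃ B₃' a₀ a₁}

/-- **THE WINDOWED NUMERICS MEET EVERY SIGN WINDOW** (`Stage12Numerics.Pos`) under `1 ≤ L`, `0 < γ < 1`, `0 < ε₀`, `0 ≤ B₃`, `0 ≤ B₃′`, `0 < a₀`, `0 < a₁` (the non-`γ` clauses are
A1's `stage12NumericsOfThm1CCM_pos`). [cite: Balaban1988Convergent, (2.4) p.255, (2.10) p.256, (2.28) p.259, (2.34)–(2.39) p.261; Balaban1987RG1, Thm 1 p.259, (0.21) p.256; Balaban1985Variational, Thm 1 p.279 (bookkeeping)] -/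
theorem stage12NumericsOfThm1CCMW_pos (hL : 1 ≤ L) (hγ0 : 0 < γ) (hγ1 : γ < 1) (hε : 0 < ε₀) (hB : 0 ≤ B₃) (hB' : 0 ≤ B₃') (ha₀ : 0 < a₀) (ha₁ : 0 < a₁) :
    (stage12NumericsOfThm1CCMW L j γ ε₀ B₃ B₃' a₀ a₁).Pos := by
  obtain ⟨h1, h2, -, h4, h5, h6, h7, h8, h9⟩ := stage12NumericsOfThm1CCM_pos (j := j) hL hε hB hB' ha₀ ha₁
  exact ⟨h1, h2, ⟨hγ0, hγ1⟩, h4, h5, h6, h7, h8, h9⟩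

/-- … in particular on the range `0 < γ ≤ ½` of the window letter. [cite: Balaban1987RG1, Thm 1 p.259 (bookkeeping)] -/
theorem stage12NumericsOfThm1CCMW_pos_of_le_half (hL : 1 ≤ L) (hγ0 : 0 < γ) (hγ : γ ≤ 1 / 2) (hε : 0 < ε₀) (hB : 0 ≤ B₃) (hB' : 0 ≤ B₃') (ha₀ : 0 < a₀) (ha₁ : 0 < a₁) :
    (stage12NumericsOfThm1CCMW L j γ ε₀ B₃ B₃' a₀ a₁).Pos :=
  stage12NumericsOfThm1CCMW_pos hL hγ0 (hγ.trans_lt (by norm_num)) hε hB hB' ha₀ ha₁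

end Numerics

/-! ## §2. ★★ THE WINDOWED COLLARED WITNESS `θ₁₅ᶜᶜᴹ(j; γ) = theta13OfThm1CCMW F N j γ ε₀ ε₂₉ B₃ B₃' a₀ a₁` and its faces -/

section Witness

variable (F : T4Family) (N : ℕ) [NeZero N] (j : ℕ) (γ ε₀ ε₂₉ B₃ B₃' a₀ a₁ : ℝ)

/-- **THE WINDOWED COLLARED STAGE-13 WITNESS** `θ₁₅ᶜᶜᴹ(j; γ; ε₀, ε₂₉; B₃, B₃′, a₀, a₁)`: FILE 9's all-numerics live witness family AT `stage12NumericsOfThm1CCMW F.L j γ ε₀ B₃ B₃' a₀ a₁`,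
with K0b's residuals of record — A1's collared member with its small-coupling window `θ.γ = γ` a letter (to be pinned to NODE O's `γ₀`); at `γ = ½` it IS A1's `θ₁₅ᶜᶜᴹ(j)`.
[cite: Balaban1989LargeFieldI, (0.3) p.176 and p.177; Balaban1987RG1, Thm 1 p.259, (0.21) p.256, §1 p.264; Balaban1988Convergent, (2.4) p.255, (2.10) p.256, (2.13) p.256, (2.28) p.259; Balaban1985RegularSpaces, (1.3)–(1.6) p.77; Balaban1985Variational, Thm 1 p.279 (bookkeeping witness)] -/
def theta13OfThm1CCMW : Stage13Params F N :=
  theta13LiveOfNumerics F N (stage12NumericsOfThm1CCMW F.L j γ ε₀ B₃ B₃' a₀ a₁) ε₂₉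
    (zeta316OfRecord F N (stage12NumericsOfThm1CCMW F.L j γ ε₀ B₃ B₃' a₀ a₁).ν (stage12NumericsOfThm1CCMW F.L j γ ε₀ B₃ B₃' a₀ a₁).τ9.M
      (stage12NumericsOfThm1CCMW F.L j γ ε₀ B₃ B₃' a₀ a₁).A₁)
    (RzOfRecord F N) (ZtOfRecord F N)

/-- Unfolding: `θ₁₅ᶜᶜᴹ(j; γ)` IS the member of the all-numerics family (`rfl`). [cite: Balaban1989LargeFieldI, (0.3) p.176 (bookkeeping)] -/
theorem theta13OfThm1CCMW_eq :
    theta13OfThm1CCMW F N j γ ε₀ ε₂₉ B₃ B₃' a₀ a₁ =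
      theta13LiveOfNumerics F N (stage12NumericsOfThm1CCMW F.L j γ ε₀ B₃ B₃' a₀ a₁) ε₂₉
        (zeta316OfRecord F N (stage12NumericsOfThm1CCMW F.L j γ ε₀ B₃ B₃' a₀ a₁).ν (stage12NumericsOfThm1CCMW F.L j γ ε₀ B₃ B₃' a₀ a₁).τ9.M
          (stage12NumericsOfThm1CCMW F.L j γ ε₀ B₃ B₃' a₀ a₁).A₁)
        (RzOfRecord F N) (ZtOfRecord F N) := rfl

/-- **★ THE `γ = ½` MEMBER IS A1's COLLARED WITNESS `θ₁₅ᶜᶜᴹ(j)`** (`rfl`) — the window edition is ADDITIVE on the landed road. [cite: Balaban1987RG1, Thm 1 p.259 (bookkeeping)] -/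
theorem theta13OfThm1CCMW_half : theta13OfThm1CCMW F N j (1 / 2) ε₀ ε₂₉ B₃ B₃' a₀ a₁ = theta13OfThm1CCM F N j ε₀ ε₂₉ B₃ B₃' a₀ a₁ := rfl

/-- **`θ₁₅ᶜᶜᴹ(j; γ).γ = γ`** (`rfl`) — the window letter. [cite: Balaban1987RG1, Thm 1 p.259 (bookkeeping)] -/
theorem theta13OfThm1CCMW_γ : (theta13OfThm1CCMW F N j γ ε₀ ε₂₉ B₃ B₃' a₀ a₁).γ = γ := rfl

/-- `θ₁₅ᶜᶜᴹ(j; γ).ν = numerics7OfThm1CCM F.L j ε₀ B₃ B₃' a₀ a₁` (`rfl`; window-blind). [cite: Balaban1988Convergent, (2.4) p.255 (bookkeeping)] -/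
theorem theta13OfThm1CCMW_ν : (theta13OfThm1CCMW F N j γ ε₀ ε₂₉ B₃ B₃' a₀ a₁).ν = numerics7OfThm1CCM F.L j ε₀ B₃ B₃' a₀ a₁ := rfl

/-- The Stage-7 numerics of the window edition ARE A1's witness's (`rfl`). [cite: Balaban1988Convergent, (2.4) p.255 (bookkeeping)] -/
theorem theta13OfThm1CCMW_ν_eq : (theta13OfThm1CCMW F N j γ ε₀ ε₂₉ B₃ B₃' a₀ a₁).ν = (theta13OfThm1CCM F N j ε₀ ε₂₉ B₃ B₃' a₀ a₁).ν := rfl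

/-- `θ₁₅ᶜᶜᴹ(j; γ).ν.εreg = a₀` (`rfl`). [cite: Balaban1985Variational, Thm 1 p.279 (bookkeeping)] -/
theorem theta13OfThm1CCMW_εreg : (theta13OfThm1CCMW F N j γ ε₀ ε₂₉ B₃ B₃' a₀ a₁).ν.εreg = a₀ := rfl

/-- `θ₁₅ᶜᶜᴹ(j; γ).ν.A₀ = A₀ᶜᶜ¹(F.L; B₃, B₃′, a₀, a₁)` (`rfl`). [cite: Balaban1988Convergent, (2.4) p.255 (bookkeeping)] -/
theorem theta13OfThm1CCMW_A₀ : (theta13OfThm1CCMW F N j γ ε₀ ε₂₉ B₃ B₃' a₀ a₁).ν.A₀ = A0OfThm1CC1 F.L B₃ B₃' a₀ a₁ := rfl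

/-- `θ₁₅ᶜᶜᴹ(j; γ).ν.p₀ = 1` (`rfl`). [cite: Balaban1988Convergent, (2.4) p.255 (bookkeeping)] -/
theorem theta13OfThm1CCMW_p₀ : (theta13OfThm1CCMW F N j γ ε₀ ε₂₉ B₃ B₃' a₀ a₁).ν.p₀ = 1 := rfl

/-- `θ₁₅ᶜᶜᴹ(j; γ).ν.r = 1` (`rfl`). [cite: Balaban1988Convergent, (2.5) p.255 (bookkeeping)] -/
theorem theta13OfThm1CCMW_r : (theta13OfThm1CCMW F N j γ ε₀ ε₂₉ B₃ B₃' a₀ a₁).ν.r = 1 := rfl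

/-- `θ₁₅ᶜᶜᴹ(j; γ).ν.M₂ = 1` (`rfl`). [cite: Balaban1988Convergent, (2.17) p.257 (bookkeeping)] -/
theorem theta13OfThm1CCMW_M₂ : (theta13OfThm1CCMW F N j γ ε₀ ε₂₉ B₃ B₃' a₀ a₁).ν.M₂ = 1 := rfl

/-- **`θ₁₅ᶜᶜᴹ(j; γ).ν.M₁ = F.L ^ j`** (`rfl`). [cite: Balaban1985RegularSpaces, (1.3)–(1.6) p.77; Balaban1988Convergent, (2.13) p.256 (bookkeeping)] -/
theorem theta13OfThm1CCMW_M₁ : (theta13OfThm1CCMW F N j γ ε₀ ε₂₉ B₃ B₃' a₀ a₁).ν.M₁ = F.L ^ j := rfl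

/-- `θ₁₅ᶜᶜᴹ(j; γ).ν.ε₀ = ε₀` (`rfl`). [cite: Balaban1987RG1, (1.2) p.260 (bookkeeping)] -/
theorem theta13OfThm1CCMW_ε₀ : (theta13OfThm1CCMW F N j γ ε₀ ε₂₉ B₃ B₃' a₀ a₁).ν.ε₀ = ε₀ := rfl

/-- `θ₁₅ᶜᶜᴹ(j; γ).ε₂₉ = ε₂₉` (`rfl`). [cite: Balaban1987RG1, (2.9) p.266 (bookkeeping)] -/
theorem theta13OfThm1CCMW_ε₂₉ : (theta13OfThm1CCMW F N j γ ε₀ ε₂₉ B₃ B₃' a₀ a₁).ε₂₉ = ε₂₉ := rfl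

/-- `θ₁₅ᶜᶜᴹ(j; γ).s2 = sect2NumericsOfThm1C F.L` (`rfl`). [cite: Balaban1988Convergent, (2.28) p.259 (bookkeeping)] -/
theorem theta13OfThm1CCMW_s2 : (theta13OfThm1CCMW F N j γ ε₀ ε₂₉ B₃ B₃' a₀ a₁).s2 = sect2NumericsOfThm1C F.L := rfl

/-- `θ₁₅ᶜᶜᴹ(j; γ).s2.cB = 6·F.L + 1` (`rfl`). [cite: Balaban1987RG1, (1.12) p.262 (bookkeeping)] -/
theorem theta13OfThm1CCMW_cB : (theta13OfThm1CCMW F N j γ ε₀ ε₂₉ B₃ B₃' a₀ a₁).s2.cB = 6 * F.L + 1 := rfl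

/-- `θ₁₅ᶜᶜᴹ(j; γ).s2.B = 7` (`rfl`). [cite: Balaban1988Convergent, (2.38) p.261 (bookkeeping)] -/
theorem theta13OfThm1CCMW_B : (theta13OfThm1CCMW F N j γ ε₀ ε₂₉ B₃ B₃' a₀ a₁).s2.B = 7 := rfl

/-- `θ₁₅ᶜᶜᴹ(j; γ).s2.C = 1` (`rfl`). [cite: Balaban1988Convergent, (2.38) p.261 (bookkeeping)] -/
theorem theta13OfThm1CCMW_C : (theta13OfThm1CCMW F N j γ ε₀ ε₂₉ B₃ B₃' a₀ a₁).s2.C = 1 := rfl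

/-- `θ₁₅ᶜᶜᴹ(j; γ).s2.Mr = 1` (`rfl`). [cite: Balaban1988Convergent, (2.38) p.261 (bookkeeping)] -/
theorem theta13OfThm1CCMW_Mr : (theta13OfThm1CCMW F N j γ ε₀ ε₂₉ B₃ B₃' a₀ a₁).s2.Mr = 1 := rfl

/-- `θ₁₅ᶜᶜᴹ(j; γ).s2.cR = 1` (`rfl`). [cite: Balaban1988Convergent, (2.10) p.256 (bookkeeping)] -/
theorem theta13OfThm1CCMW_cR : (theta13OfThm1CCMW F N j γ ε₀ ε₂₉ B₃ B₃' a₀ a₁).s2.cR = 1 := rfl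

/-- `θ₁₅ᶜᶜᴹ(j; γ).s2.βc = ¼` (`rfl`). [cite: Balaban1988Convergent, (2.34) p.261 (bookkeeping)] -/
theorem theta13OfThm1CCMW_βc : (theta13OfThm1CCMW F N j γ ε₀ ε₂₉ B₃ B₃' a₀ a₁).s2.βc = 1 / 4 := rfl

/-- `θ₁₅ᶜᶜᴹ(j; γ).s2.lf.κ = 2·10⁴` (`rfl`). [cite: Balaban1987RG1, (1.18) p.263 (bookkeeping)] -/
theorem theta13OfThm1CCMW_κ : (theta13OfThm1CCMW F N j γ ε₀ ε₂₉ B₃ B₃' a₀ a₁).s2.lf.κ = 20000 := rfl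

/-- The term constants of record at `θ₁₅ᶜᶜᴹ(j; γ)` ARE the family's with `γ := γ` (`rfl`). [cite: Balaban1988Convergent, (2.28) p.259 (bookkeeping)] -/
theorem lfOfRecord₁₂_theta13OfThm1CCMW :
    lfOfRecord₁₂ F N (theta13OfThm1CCMW F N j γ ε₀ ε₂₉ B₃ B₃' a₀ a₁).toStage12Params = { lfConstsOfFamily with γ := γ } := rfl

/-- **`θ₁₅ᶜᶜᴹ(j; γ).τ9.M = F.L ^ j`** (`rfl`). [cite: Balaban1989LargeFieldI, (2.1) p.182; Balaban1987RG1, (1.12) p.262 (bookkeeping)] -/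
theorem theta13OfThm1CCMW_τ9_M : (theta13OfThm1CCMW F N j γ ε₀ ε₂₉ B₃ B₃' a₀ a₁).τ9.M = F.L ^ j := rfl

/-- The tower numerics of the window edition ARE A1's witness's (`rfl`). [cite: Balaban1989LargeFieldI, (2.1) p.182 (bookkeeping)] -/
theorem theta13OfThm1CCMW_τ9_eq : (theta13OfThm1CCMW F N j γ ε₀ ε₂₉ B₃ B₃' a₀ a₁).τ9 = (theta13OfThm1CCM F N j ε₀ ε₂₉ B₃ B₃' a₀ a₁).τ9 := rfl

/-- `θ₁₅ᶜᶜᴹ(j; γ).A₁ = 1` (`rfl`). [cite: Balaban1987RG1, (1.16) p.262 (bookkeeping)] -/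
theorem theta13OfThm1CCMW_A₁ : (theta13OfThm1CCMW F N j γ ε₀ ε₂₉ B₃ B₃' a₀ a₁).A₁ = 1 := rfl

/-- `θ₁₅ᶜᶜᴹ(j; γ).Rz = RzOfRecord F N` (`rfl`). [cite: Balaban1988Convergent, (2.21) p.258 (bookkeeping)] -/
theorem theta13OfThm1CCMW_Rz : (theta13OfThm1CCMW F N j γ ε₀ ε₂₉ B₃ B₃' a₀ a₁).Rz = RzOfRecord F N := rfl

/-- The β-layer data of the window edition ARE A1's witness's: `εbg` (`rfl`). [cite: Balaban1987RG1, (0.21) p.256 (bookkeeping)] -/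
theorem theta13OfThm1CCMW_εbg : (theta13OfThm1CCMW F N j γ ε₀ ε₂₉ B₃ B₃' a₀ a₁).εbg = (theta13OfThm1CCM F N j ε₀ ε₂₉ B₃ B₃' a₀ a₁).εbg := rfl

/-- … and the base histories `v₀` (`rfl`). [cite: Balaban1987RG1, (2.12)–(2.14) p.268 (bookkeeping)] -/
theorem theta13OfThm1CCMW_v₀ : (theta13OfThm1CCMW F N j γ ε₀ ε₂₉ B₃ B₃' a₀ a₁).v₀ = (theta13OfThm1CCM F N j ε₀ ε₂₉ B₃ B₃' a₀ a₁).v₀ := rfl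

/-- `θ₁₅ᶜᶜᴹ(j; γ).ℓ₆ + 1 = F.L`. [cite: Balaban1987RG1, (0.1) p.251 (bookkeeping)] -/
theorem theta13OfThm1CCMW_ℓ₆_succ : (theta13OfThm1CCMW F N j γ ε₀ ε₂₉ B₃ B₃' a₀ a₁).ℓ₆ + 1 = F.L := stage3OfFamily_ℓ₆_succ F

/-- N10's Lemma-3 level-T binder at `θ₁₅ᶜᶜᴹ(j; γ)`: `8 ≤ θ.ℓ₆ + 1`. [cite: Balaban1987RG1, (0.1) p.251; Balaban1988RG2Cluster, (2.36) p.19] -/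
theorem eight_le_L_theta13OfThm1CCMW : 8 ≤ (theta13OfThm1CCMW F N j γ ε₀ ε₂₉ B₃ B₃' a₀ a₁).ℓ₆ + 1 := eight_le_L_stage3OfFamily F

/-- Row N1 at `θ₁₅ᶜᶜᴹ(j; γ)`: the (D4) `tree` numeral. [cite: Balaban1987RG1, (0.25)–(0.26) p.257] -/
theorem kp_tree_theta13OfThm1CCMW : 128 * Real.log 162 ≤ (theta13OfThm1CCMW F N j γ ε₀ ε₂₉ B₃ B₃' a₀ a₁).s2.lf.κ := kp_tree_lfConstsOfFamily

/-- Row N1 at `θ₁₅ᶜᶜᴹ(j; γ)`: the (D4) `large` numeral at the family's block size. [cite: Balaban1987RG1, (0.25)–(0.26) p.257; Balaban1988RG2Cluster, p.21 (after (2.39))] -/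
theorem kp_large_theta13OfThm1CCMW :
    10 * (64 * Real.log 162 + 1) ≤
      (((((theta13OfThm1CCMW F N j γ ε₀ ε₂₉ B₃ B₃' a₀ a₁).ℓ₆ + 1 : ℕ) : ℝ)) / 2 - 1) * (theta13OfThm1CCMW F N j γ ε₀ ε₂₉ B₃ B₃' a₀ a₁).s2.lf.κ :=
  kp_large_theta13OfThm1CCM F N j ε₀ ε₂₉ B₃ B₃' a₀ a₁

/-- Row N1 at `θ₁₅ᶜᶜᴹ(j; γ)`: N10's rate threshold. [cite: Balaban1987RG1, (1.18) p.263 (bookkeeping numeral)] -/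
theorem kp_n10_theta13OfThm1CCMW : (2 * 10 ^ 4 : ℝ) ≤ (theta13OfThm1CCMW F N j γ ε₀ ε₂₉ B₃ B₃' a₀ a₁).s2.lf.κ := kp_n10_lfConstsOfFamily

/-- `θ₁₅ᶜᶜᴹ(j; γ)` carries K0b's residuals of record (`⟨rfl, rfl, rfl⟩`). [cite: Balaban1988Convergent, (3.16) p.268, (2.21) p.258, (3.20) p.269 (bookkeeping)] -/
theorem hasResidualsOfRecord_theta13OfThm1CCMW : (theta13OfThm1CCMW F N j γ ε₀ ε₂₉ B₃ B₃' a₀ a₁).HasResidualsOfRecord F N :=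
  hasResidualsOfRecord_theta13LiveOfNumerics F N (stage12NumericsOfThm1CCMW F.L j γ ε₀ B₃ B₃' a₀ a₁) ε₂₉

/-- **… hence `ZtUnity` at `θ₁₅ᶜᶜᴹ(j; γ)`** (row Z). [cite: Balaban1988Convergent, (3.16)–(3.20) pp.268–269] -/
theorem ztUnity_theta13OfThm1CCMW : (theta13OfThm1CCMW F N j γ ε₀ ε₂₉ B₃ B₃' a₀ a₁).ZtUnity F N :=
  ztUnity_theta13LiveOfNumerics F N (stage12NumericsOfThm1CCMW F.L j γ ε₀ B₃ B₃' a₀ a₁) ε₂₉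

variable {j γ ε₀ ε₂₉ B₃ B₃' a₀ a₁} in
/-- **`θ₁₅ᶜᶜᴹ(j; γ)` IS STAGE-13 ADMISSIBLE under `0 < γ < 1` and the signs `0 < ε₀`, `0 < ε₂₉`, `0 ≤ B₃`, `0 ≤ B₃′`, `0 < a₀`, `0 < a₁`** (row G; `1 ≤ F.L`). [cite: Balaban1987RG1, Thm 1 p.259, (0.21) p.256, (1.2) p.260, (2.9) p.266; Balaban1988Convergent, (2.10) p.256; Balaban1985Variational, Thm 1 p.279 (bookkeeping witness)] -/
theorem admissible_theta13OfThm1CCMW (hγ0 : 0 < γ) (hγ1 : γ < 1) (hε : 0 < ε₀) (hε' : 0 < ε₂₉) (hB : 0 ≤ B₃) (hB' : 0 ≤ B₃') (ha₀ : 0 < a₀) (ha₁ : 0 < a₁) :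
    (theta13OfThm1CCMW F N j γ ε₀ ε₂₉ B₃ B₃' a₀ a₁).Admissible F N :=
  admissible_theta13LiveOfNumerics F N _ _ _ (stage12NumericsOfThm1CCMW_pos F.hL.2.le hγ0 hγ1 hε hB hB' ha₀ ha₁) hε'

variable {j γ ε₀ ε₂₉ B₃ B₃' a₀ a₁} in
/-- … in particular on the range `0 < γ ≤ ½` of the window letter. [cite: Balaban1987RG1, Thm 1 p.259 (bookkeeping)] -/
theorem admissible_theta13OfThm1CCMW_of_le_half (hγ0 : 0 < γ) (hγ : γ ≤ 1 / 2) (hε : 0 < ε₀) (hε' : 0 < ε₂₉) (hB : 0 ≤ B₃) (hB' : 0 ≤ B₃') (ha₀ : 0 < a₀) (ha₁ : 0 < a₁) :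
    (theta13OfThm1CCMW F N j γ ε₀ ε₂₉ B₃ B₃' a₀ a₁).Admissible F N :=
  admissible_theta13OfThm1CCMW F N hγ0 (hγ.trans_lt (by norm_num)) hε hε' hB hB' ha₀ ha₁

/-- **★ Row P12 at `θ₁₅ᶜᶜᴹ(j; γ)` HYPOTHESIS-FREE** (FILE 9 v1.1). [cite: Balaban1988Convergent, (3.22) p.269, (3.24) p.270; Balaban1989LargeFieldI, (0.3)–(0.4) p.176] -/
theorem slotsNondegenerate₁₃_theta13OfThm1CCMW : (theta13OfThm1CCMW F N j γ ε₀ ε₂₉ B₃ B₃' a₀ a₁).SlotsNondegenerate₁₃ F N :=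
  slotsNondegenerate₁₃_theta13LiveOfNumerics_of_hasResiduals F N (stage12NumericsOfThm1CCMW F.L j γ ε₀ B₃ B₃' a₀ a₁) ε₂₉

end Witness

end Literature.MathematicalPhysics.QuantumFieldTheory.Balaban1983to89.Node00

end
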